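import Mathlib
import HarnessLib
import Literature.NumberTheory.DiophantineGeometry.AVGaloisModule
import Literature.NumberTheory.GaloisRepresentations.GaloisRep
import Literature.NumberTheory.Automorphic.Paramodular.ParamodularForms

/-!
# "The abelian surface `A` is paramodular of level `N`": `L_p(A,T) = Q_p(f,T)`

The CONCLUSION shape of the paramodularity theorems of Brumer–Pacetti–Poor–Tornaría–Voight–Yuen
[BrumerEtAl2019, Thm 7.1.3 / 7.2.1 / 7.3.1] ("For all primes `p`, we have
`L_p(A_N,T) = Q_p(f_N,T)`. In particular, … the abelian surface `A_N` is paramodular."), typed in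
the tree's vocabulary: the abelian variety `A : AbelianVariety ℚ` with its rational `ℓ`-adic Tate
modules `V_ℓ A = A.rationalTateModule ℓ` and Galois action `A.rationalTateRep ℓ`
(`Literature/NumberTheory/DiophantineGeometry/AVGaloisModule.lean`), framed Galois representations
`FramedGaloisRep ℚ ℚ_ℓ 4` with `IsUnramifiedAt`, `HasFrobCharpolyAt` (arithmetic Frobenius,
`Literature/NumberTheory/GaloisRepresentations/GaloisRep.lean`), and the paramodular side of
`ParamodularForms.lean` (`IsParamodularCuspForm`, `HasSpinorEulerFactorAt`).

## What is printed
[BrumerEtAl2019, (4.1.3)–(4.1.5)]: for a polarized abelian variety `A/ℚ` of conductor `N` and a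
prime `ℓ`, the Tate module `T_ℓ A = lim A[ℓⁿ]` gives `ρ_{A,ℓ} : Gal_{ℚ,S} → GSp₄(ℤ_ℓ)`, unramified
outside `ℓN`; for `p ≠ ℓ`, `L_p(A,T) := det(1 - T Frob_p^* | H¹_ét(A^al, ℚ_ℓ)^{I_p})` (geometric
Frobenius on `H¹`) is independent of `ℓ`, and for `p ∤ ℓN`,
`det(1 - ρ_{A,ℓ}(Frob_p) T) = L_p(A,T) = 1 - a_p T + b_{p²} T² - p a_p T³ + p² T⁴` (arithmetic
Frobenius on `T_ℓ A`; `H¹` is the dual of `V_ℓ A`, and the characteristic polynomial of geometric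
Frobenius on the dual equals that of arithmetic Frobenius on `V_ℓ A`). Conclusion of Thm 7.1.3:
`L_p(A,T) = Q_p(f,T)` for all primes `p`, i.e. `L(A,s) = L(f,s,spin)`, "`A` is paramodular".

## What is here
* `AbelianVariety.IsFrameOfTateRep A ℓ b r` — `r : Gal_ℚ → GL₄(ℚ_ℓ)` (continuous, framed) is the
  matrix form of `A.rationalTateRep ℓ` in the `ℚ_ℓ`-basis `b` of `V_ℓ A` (NO dual, NO inverse: the
  [BrumerEtAl2019] convention `ρ_{A,ℓ}` on the Tate module; contrast the `H¹`-frame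
  `(r g) = (ρ(g⁻¹))ᵀ` used by `Summit…RegularSerreAbelianSurfaces.AbelianSurfacesModular`, whose
  arithmetic-Frobenius polynomial is `X⁴ L_p(1/(pX)) p²`-renormalised — the two must not be mixed).
* `AbelianVariety.HasGoodEulerFactorAt A p L` — "`L = L_p(A,T) ∈ 1 + Tℚ[T]` and `p` is good": for
  every prime `ℓ ≠ p`, every basis `b` and frame `r`, and every place `v ∣ p`, `r` is unramified at
  `v` and the arithmetic Frobenius there has characteristic polynomial `X⁴ L(1/X)`
  (`Polynomial.reverse L`; (4.1.5) read as `det(X - ρ_{A,ℓ}(Frob_p)) = X⁴ L_p(A, 1/X)`).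
* `IsParamodularAwayFrom A N f` — `f ∈ S₂(K(N))`, `f ≢ 0` on `ℍ₂`, and for every prime `p ∤ N`
  there is ONE polynomial `Q ∈ ℚ[T]` which is both `Q_p(f,T)` (via `HasSpinorEulerFactorAt 2 p f`,
  coefficients pushed to `ℂ`) and `L_p(A,T)` (via `HasGoodEulerFactorAt`): the equalities
  `L_p(A,T) = Q_p(f,T)` of Thm 7.1.3 at all `p ∤ N` (rationality of `Q_p(f,T)` included, as for
  the forms with rational eigenvalues of the paramodular conjecture).

## Not here (deliberately)
The bad primes `p ∣ N` (their `L_p` needs `H¹(A)^{I_p}`, (4.1.4), and `Q_p` at `p ∣ N` the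
paramodular newform theory); "`N = cond(A)`" (the conductor of an abelian variety is not in the
tree); the GL₄/GSp₄-automorphic formulation (BCGP; see the `H¹`-frame remark above); any claim that
a Jacobian of a given genus-2 curve IS such an `A` (no Jacobians in the tree — certificate theorems
take the curve's Euler factors as cited/computed data about `A`).
-/

namespace Literature.NumberTheory.Automorphic.Paramodular

open Literature.NumberTheory.GaloisRepresentations Literature.AlgebraicGeometry.Motives
  IsDedekindDomain NumberField

/-- `r : Gal_ℚ →ₜ* GL₄(ℚ_ℓ)` is the matrix form, in the `ℚ_ℓ`-basis `b` of the rational Tate module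
`V_ℓ A`, of the Galois action `A.rationalTateRep ℓ` — the representation `ρ_{A,ℓ}` of
[BrumerEtAl2019, (4.1.3)] tensored with `ℚ_ℓ` (on the Tate module itself, arithmetic action; not
the dual `H¹`). Continuity is carried by the type of `r`. [cite: BrumerEtAl2019, (4.1.3)] -/
def _root_.Literature.AlgebraicGeometry.Motives.AbelianVariety.IsFrameOfTateRep
    (A : AbelianVariety ℚ) (ℓ : ℕ) [Fact ℓ.Prime]
    (b : Module.Basis (Fin 4) ℚ_[ℓ] (A.rationalTateModule ℓ)) (r : FramedGaloisRep ℚ ℚ_[ℓ] 4) :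
    Prop :=
  ∀ g : Field.absoluteGaloisGroup ℚ, (r g).val = LinearMap.toMatrix b b (A.rationalTateRep ℓ g)

/-- **`L` is the good Euler factor `L_p(A,T)` of the abelian surface `A` at `p`**
[BrumerEtAl2019, (4.1.4)–(4.1.5)]: for every prime `ℓ ≠ p`, every `ℚ_ℓ`-basis `b` of `V_ℓ A`
(indexed by `Fin 4`: `A` is a surface) and every continuous frame `r` of `ρ_{A,ℓ} ⊗ ℚ_ℓ` in `b`,
and every finite place `v` of `ℚ` above `p`, the representation `r` is unramified at `v` and every
arithmetic Frobenius at `v` has characteristic polynomial `X⁴ L(1/X) = Polynomial.reverse L`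
(so `det(1 - ρ_{A,ℓ}(Frob_p)T) = L(T)`, independent of `ℓ`). For `L = 1 - aT + bT² - paT³ + p²T⁴`
this says `a = a_p(A) = tr ρ_{A,ℓ}(Frob_p)`, `b = b_{p²}(A)`. [cite: BrumerEtAl2019, (4.1.5)] -/
def _root_.Literature.AlgebraicGeometry.Motives.AbelianVariety.HasGoodEulerFactorAt
    (A : AbelianVariety ℚ) (p : ℕ) (L : Polynomial ℚ) : Prop :=
  ∀ (ℓ : ℕ) [Fact ℓ.Prime], ℓ ≠ p →
    ∀ (b : Module.Basis (Fin 4) ℚ_[ℓ] (A.rationalTateModule ℓ)) (r : FramedGaloisRep ℚ ℚ_[ℓ] 4),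
      A.IsFrameOfTateRep ℓ b r →
        ∀ v : HeightOneSpectrum (𝓞 ℚ), ((p : ℕ) : 𝓞 ℚ) ∈ v.asIdeal →
          r.IsUnramifiedAt v ∧ r.HasFrobCharpolyAt v (L.reverse.map (algebraMap ℚ ℚ_[ℓ]))

/-- **`A` is paramodular of level `N` with paramodular form `f`, away from the level**
[BrumerEtAl2019, conclusion of Thm 7.1.3 / 7.2.1 / 7.3.1 restricted to `p ∤ N`]:
`f ∈ S₂(K(N))` is a weight-2 paramodular cusp form, not identically zero on `ℍ₂`, and for every
prime `p ∤ N` there is a polynomial `Q ∈ 1 + Tℚ[T]` with `Q = Q_p(f,T)` — `f` is a `T(p)`-,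
`T₁(p²)`-eigenfunction and `Q` is its spinor Euler factor (4.2.18), in particular the eigenvalues
are rational — and `Q = L_p(A,T)` in the sense of `HasGoodEulerFactorAt` (so `p` is good for `A`).
The level is a parameter; "`N = cond(A)`" and the bad Euler factors are not part of this
predicate (see the module docstring). [cite: BrumerEtAl2019, Thm 7.1.3] -/
def IsParamodularAwayFrom (A : AbelianVariety ℚ) (N : ℕ) [NeZero N]
    (f : Matrix (Fin 2) (Fin 2) ℂ → ℂ) : Prop :=
  IsParamodularCuspForm N 2 f ∧ (∃ Z ∈ siegelUpperHalfSpace 2, f Z ≠ 0) ∧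
    ∀ p : ℕ, p.Prime → ¬ p ∣ N →
      ∃ Q : Polynomial ℚ, HasSpinorEulerFactorAt 2 p f (Q.map (algebraMap ℚ ℂ)) ∧
        A.HasGoodEulerFactorAt p Q

/-- Unfolding: a paramodular `A` has, at each `p ∤ N`, a common rational Euler factor for `A` and
`f`. [cite: BrumerEtAl2019, Thm 7.1.3] -/
theorem IsParamodularAwayFrom.exists_eulerFactor {A : AbelianVariety ℚ} {N : ℕ} [NeZero N]
    {f : Matrix (Fin 2) (Fin 2) ℂ → ℂ} (h : IsParamodularAwayFrom A N f) {p : ℕ} (hp : p.Prime)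
    (hpN : ¬ p ∣ N) :
    ∃ Q : Polynomial ℚ, HasSpinorEulerFactorAt 2 p f (Q.map (algebraMap ℚ ℂ)) ∧
      A.HasGoodEulerFactorAt p Q :=
  h.2.2 p hp hpN

/-- The common Euler factor at `p ∤ N` of a paramodular pair `(A, f)` is unique (as `f ≢ 0`
determines its Hecke eigenvalues): any two spinor Euler factors of `f` at `p` with rational
coefficients coincide. [cite: BrumerEtAl2019, Thm 7.1.3] -/
theorem IsParamodularAwayFrom.eulerFactor_unique {A : AbelianVariety ℚ} {N : ℕ} [NeZero N]
    {f : Matrix (Fin 2) (Fin 2) ℂ → ℂ} (h : IsParamodularAwayFrom A N f) {p : ℕ}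
    {Q Q' : Polynomial ℚ}
    (hQ : HasSpinorEulerFactorAt 2 p f (Q.map (algebraMap ℚ ℂ)))
    (hQ' : HasSpinorEulerFactorAt 2 p f (Q'.map (algebraMap ℚ ℂ))) : Q = Q' := by
  have hinj : Function.Injective (algebraMap ℚ ℂ) := (algebraMap ℚ ℂ).injective
  have := hQ.unique hQ' h.2.1
  exact Polynomial.map_injective _ hinj this

end Literature.NumberTheory.Automorphic.Paramodular
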